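import Summits.BirchSwinnertonDyer.BirchSwinnertonDyer.Theorems.MordellShaFreeCutKatoZetaRoadPinnedH2AtPin
import Summits.BirchSwinnertonDyer.BirchSwinnertonDyer.Theorems.CongruentShaFreeCutKatoReading31b
import Summits.BirchSwinnertonDyer.BirchSwinnertonDyer.Theorems.CongruentShaFreeCutKatoReadingsOfNontrivialH1
import Summits.BirchSwinnertonDyer.BirchSwinnertonDyer.Theorems.CongruentShaFreeCutIntegralH1RankLeOne
import Literature.NumberTheory.EllipticCurves.Kato2004.IwasawaH1RankLeOneProofs
import Literature.NumberTheory.EllipticCurves.Kato2004.LocPKernelRankOneProofs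
import Literature.NumberTheory.EllipticCurves.Kato2004.IwasawaH1RankLowerBoundProofs
import HarnessLib

set_option linter.dupNamespace false
set_option autoImplicit false

/-! # Route `MordellShaFreeCut` (rung S2b) — crux B `AnalyticRankOneOfRankOneFiniteShaThree`
# (stmt-BirchSwinnertonDyer-19160) on the Kato–zeta / Perrin-Riou road AFTER (α), (R1) AND (R2): the road's two
# Kato readings fed AT THE PIN from (NT) «`𝐇¹_Γ(T₃W) ≠ 0`» (the Euler-system-free inequality half of Kato's
# Euler–Poincaré count (12.2.2)), and the census «crux B ⟸ six refereed theorems ∧ (NT) ∧ `PRFormulaAtThreeH2`»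

Cell `bsd-cn100`, prover seat `bsd-cn100-s2b-c3` (g18; §4 appended by g22); the `j = 0` / `p = 3` twin of seat
`bsd-cn100-s2-c3` g12's census for route `CongruentShaFreeCut` (plan g19 RULING-5 (4), 2026-08-27T08:24:36Z: «S2b: the
p = 3 instance by the next s2b-c3 seat»). THEOREMS ONLY (0 `def`, 0 new named fact); supports, does not close,
stmt-BirchSwinnertonDyer-19160. PARTITION: none — RANK axis.

## Why this file (the v1g → v1h step of the registered line `kato-zeta-perrin-riou`)

The registered skeleton on 19160 (v1g, sha256 110a95b8…, plan g19 act (xiv) 08:23:05Z) has the citation-borne stub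
`stub_refereedInputs` = RI7 = six refereed theorems ∧ `Kato2004.thm12_4`, and the research stub
`stub_prFormulaAtThree : PRFormulaAtThreeH2`. Of `thm12_4` [(12.2.1) f.g. ∧ Thm. 12.4 (2) (torsion free ∧ `Λ`-rank
one) ∧ Thm. 12.4 (3)] the road consumes, through `readingRK_of_facts` and the (R1) corollary, exactly f.g., torsion
free and `rank = 1`, and it consumes them only AT THE PIN of the curve under crux B's own hypotheses (rank one,
`Ш[3^∞]` finite). Three of these are now TREE THEOREMS: f.g. = `IwasawaH1Data.module_finite_of_isCyclotomic`
((α) lane, p510488), torsion free = `IwasawaH1Data.isTorsionFree` (p491527), and — under the crux hypotheses —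
`rank ≤ 1` = (R2) `IwasawaH1Data.rank_le_one_of_rank_integralH1_le_one` (p514042) over (R1)
`CongruentShaFreeCutIntegralH1RankLeOne.rank_integralH1_layerZero_le_one` (p508547). What is left is the single bit
(NT) «`𝐇¹_Γ(T_pW) ≠ 0`» (`Nontrivial I.H`): the existence of ONE non-zero norm-compatible family of integral
classes up the cyclotomic tower — the LOWER bound `1 ≤ rank_Λ 𝐇¹`, which is the Euler-system-FREE inequality half
of the Euler–Poincaré identity (12.2.2) [Astérisque 295 p. 220, «known», citing Tate 1966 (Sém. Bourbaki 306,
Thm. 2.2) and Perrin-Riou 1995 (Astérisque 229 §1.3); refereed twin Greenberg 1999, LNM 1716 §4, proof of Prop. 4.9,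
`p = 2` included]; Kato's zeta elements (non-vanishing, Thm. 12.5 with Rohrlich) enter only Thm. 12.4 (1) = the UPPER
bound `rank_Λ 𝐇¹ ≤ 1`, which this road takes instead from (R1)/(R2) under the crux hypotheses (DOC pointer N-S7-1,
bsd-cited-r01 2026-08-27T09:20:18Z; plan g20 RULING-2 (6)). This file makes that accounting a kernel-checked signature
for crux B of S2b:

* (companion file `MordellShaFreeCutKatoZetaRoadPinnedH2AtPin`, this seat, same day) — the v2-pinned composition
  of `MordellShaFreeCutKatoZetaRoadPinnedH2` (p467387) RE-CUT so that the (R+K) reading `hRK` is asked only AT THE PIN,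
  i.e. under `rank W(ℚ) = 1 ∧ #Ш(W)[3^∞] < ∞` (`cruxB_of_prFormulaH2_of_readingsAtPin`; same proof — the landed
  composition already uses `hRK W hj` only after the crux hypotheses are introduced); needed because (R2) bounds
  `rank_Λ 𝐇¹_Γ` only under those hypotheses, whereas v1g's `readingRK` slot quantifies over every `j = 0` curve.
* §1 — the two readings AT THE PIN from (NT) alone: `readingRK_jZero_three_of_nontrivialAtPin` (a pinned datum with
  the char-ideal relation, `z` CHOSEN by module algebra — one line over seat s2-c3 g12's `W`,`p`-generic
  `CongruentShaFreeCutKatoReadingsOfNontrivialH1.exists_pin_charIdeal_rel_of_nontrivial_of_rankOne`, p515014) and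
  `reading31_jZero_three_of_nontrivialAtPin` ((3.1′): `D.H2/T·D.H2` finite), over the tree theorems (α), tf, (R1), (R2),
  `finite_descentCokernel_of_rank_le_one`, `finite_coinvariants_H2_iff_finite_descentCokernel`. (NT) is displayed in
  its WEAKEST, crux-local form at `p = 3` (g12's file displays the global and the all-`p` crux-local forms).
* §2 — the census **crux B ⟸ six refereed theorems ∧ (NT) ∧ `PRFormulaAtThreeH2`**, with (NT) in three displayed
  currencies: crux-local at `p = 3` (`cruxB_of_sixFacts_of_nontrivialAtPin_of_prFormulaH2`), global `Nontrivial I.H`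
  (the display of `Kato2004.nontrivial_iwasawaH1_of_thm12_4`, p514042; `cruxB_of_sixFacts_of_nontrivial_of_prFormulaH2`),
  and global `1 ≤ Module.rank Λ I.H` (`cruxB_of_sixFacts_of_oneLeRank_of_prFormulaH2`; this is, binder for binder,
  the body named by plan g19 RULING-5 (3) for the typer's future Literature def `Kato2004.one_le_rank_iwasawaH1`,
  so a v1h skeleton whose stub carries that def composes through `cruxB_of_RI7prime_of_prFormulaH2` by a one-liner);
  (3.1″) is fed by name from the tree theorem `Kato2004.locP_kernel_isTorsion_of_rankOne_holds` exactly as in v1g.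
* §3 — monotonicity (ACT TEST (i) of RULING-4 (3b)): `thm12_4 → (1 ≤ rank)` and RI7 → RI7′, one line each; the
  converse is not claimed (clause (3) of Thm. 12.4 and `rank ≤ 1` off the crux hypotheses are not recovered).
* §4 (seat g22, after the def `Kato2004.one_le_rank_iwasawaH1` (p516793/p517993) and the plan's registry act (xvi) v1h
  on 19160) — the same census in the DEF-NAMED RI7′ currency: `cruxB_of_sixFacts_of_oneLeRankFact_of_prFormulaH2` and
  the bundled `cruxB_of_registeredRI7prime_of_prFormulaH2`, whose two hypotheses are, token for token, the registered
  signatures of `stub_refereedInputs` and `stub_prFormulaAtThree` (the v1h `_of_stubs` as a TREE theorem).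

HONEST FRAMING. Everything here is plumbing over PROVED tree theorems ((α) bsd-potss-rkm g8, torsion-freeness
bsd-potss-rkm g7, (R1)/(R2) bsd-cn100-s2-c3 g11/g12) plus displayed hypotheses. (NT) is NOT proved (no Euler system
and no Euler–Poincaré count over `Λ` is in the tree); the six refereed inputs stay citation-borne; `PRFormulaAtThreeH2`
(Perrin-Riou's formula for Kato's zeta element at the ADDITIVE prime `3` of the `j = 0` curves) stays OPEN with 0
sources; nothing about crux B, the leaf `rankOne_threeConverse_mordellCurve`, Sylvester's problem or any case of BSD is
proved. Build rule (H): concludes the route decl BY NAME through the S2b-cone file `MordellShaFreeCutKatoZetaRoadPinnedH2AtPin`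
(→ `…PinnedH2` → `MordellShaFreeCutOfHeegnerNonTorsion`); the other imports are Theses-free and `W`,`p`-generic
(`CongruentShaFreeCutIntegralH1RankLeOne`, `CongruentShaFreeCutKatoReadingsOfNontrivialH1`, `CongruentShaFreeCutKatoReading31b`
despite their names; `Kato2004/*`).

References: [Kato2004Asterisque] §12.2 (12.2.1)–(12.2.2) (p. 220), Thm. 12.4 (p. 221), Thm. 12.5 (p. 222), Conj. 12.10
(p. 224), §14.9 (14.9.3) (p. 240), §14.14 (14.14.1)–(14.14.2) (p. 243), Cor. 14.3; [GreenbergLNM1716] §4, Prop. 4.9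
(proof); [AlpogeBhargavaShnidman2022] App. A (Burungale–Skinner) Thm. 10.1, Thm. 10.6, Thm. 10.8, §10.1.1–§10.1.3;
[BurungaleTian2026] Thm. 2.6, Thm. 3.1; [GrossZagier1986] Thm. I.6.3; [DokchitserDokchitserAnnals2010] Thm. 1.4.
-/

noncomputable section

open scoped Classical

open WeierstrassCurve NumberField IsDedekindDomain Field Literature.NumberTheory.EllipticCurves
  Literature.NumberTheory.EllipticCurves.Kato2004 Literature.NumberTheory.EllipticCurves.IwasawaAlgebra
  Literature.NumberTheory.EllipticCurves.Kato2004.EulerSystemValues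
  Literature.NumberTheory.GaloisRepresentations
  Summit.BirchSwinnertonDyer.Rank1Residual.Additive
  Summit.BirchSwinnertonDyer.BirchSwinnertonDyer.Theses.MordellShaFreeCut
  Summit.BirchSwinnertonDyer.BirchSwinnertonDyer.Theorems.CongruentShaFreeCutKatoDescentDatumOfH2
  Summit.BirchSwinnertonDyer.BirchSwinnertonDyer.Theorems.MordellShaFreeCutKatoZetaRoadPinnedH2
open Summit.BirchSwinnertonDyer.BirchSwinnertonDyer.Theorems.MordellShaFreeCutKatoZetaRoadPinnedH2AtPin
  (cruxB_of_prFormulaH2_of_readingsAtPin)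
open Summit.BirchSwinnertonDyer.BirchSwinnertonDyer.Theorems.CongruentShaFreeCutKatoReadingsOfNontrivialH1
  (exists_pin_charIdeal_rel_of_nontrivial_of_rankOne)
open Summit.BirchSwinnertonDyer.BirchSwinnertonDyer.Theorems.CongruentShaFreeCutIntegralH1RankLeOne
  (rank_integralH1_layerZero_le_one)
open Summit.BirchSwinnertonDyer.BirchSwinnertonDyer.Theorems.CongruentShaFreeCutKatoReading31b
  (reading31b_three_of_fact)

namespace Summit.BirchSwinnertonDyer.BirchSwinnertonDyer.Theorems.MordellShaFreeCutKatoZetaRoadNontrivialH1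

/-! ## §1 The readings AT THE PIN from (NT) «`𝐇¹_Γ(T₃W) ≠ 0`» over the tree theorems (α), tf, (R1), (R2) -/

/-- **Reading (R+K) of the road at `j = 0`, `p = 3`, AT THE PIN, from (NT) alone — crux-local form.** For every
globally minimal elliptic `W/ℚ` with `j(W) = 0`, `rank W(ℚ) = 1` and `Ш(W)[3^∞]` finite: GRANTED (NT) in its
crux-local form at `p = 3` — «for every cyclotomic pin `I : IwasawaH1Data W 3 κ γ` of such a `W`, `I.H = 𝐇¹_Γ(T₃W) ≠ 0`»
— there is a v2-pinned Kato descent datum `D` of `(W, 3)` with `∃ a b, (3^a)·char(D.H2) = (3^b)·char(D.H ⧸ Λ D.z)`.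
One line over seat bsd-cn100-s2-c3 g12's `W`,`p`-generic
`CongruentShaFreeCutKatoReadingsOfNontrivialH1.exists_pin_charIdeal_rel_of_nontrivial_of_rankOne` (p515014; ingredients:
the cyclotomic `ℤ₃`-extension, the pin `nonempty_iwasawaH1Data_holds`, the package `nonempty_iwasawaH2Data_holds` (α),
f.g. + torsion free + `rank_Λ = 1` AT THE PIN from (NT), (R1) `rank_integralH1_layerZero_le_one` and (R2)
`IwasawaH1Data.thm12_4_clauses_of_nontrivial_of_rank_integralH1_le_one`, and the CHOICE of `z` by module algebra),
whose curve-level hypothesis «`∀ κ γ I, Nontrivial I.H`» is supplied, for the `W` at hand, by the crux-local (NT).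
The char-ideal relation is realised by the choice of `z`; this is NOT Kato's Main Conjecture for the zeta element.
The same shape from the GLOBAL (NT) is g12's `readingRK_jZero_three_of_nontrivial`. CONDITIONAL on (NT) only.
[cite: Kato2004Asterisque, §12.2 (12.2.1)–(12.2.2) (p. 220), Thm. 12.4 (2) (p. 221), §14.14 (14.14.1) (p. 243)] -/
theorem readingRK_jZero_three_of_nontrivialAtPin
    (hNT : ∀ (W : WeierstrassCurve ℚ) [W.IsElliptic] [ContinuousSMul ℤ_[3] (W.tateModule 3)]
      (κ : ZpExtension ℚ 3) (γ : absoluteGaloisGroup ℚ), κ.IsCyclotomic → κ.IsTopGenerator γ →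
        ∀ I : IwasawaH1Data W 3 κ γ, W.j = 0 → W.mordellWeilRank = 1 →
          Finite (AddCommGroup.primaryComponent W.sha 3) → Nontrivial I.H) :
    ∀ (W : WeierstrassCurve ℚ) [W.IsElliptic] [W.IsGloballyMinimal]
      [ContinuousSMul ℤ_[3] (W.tateModule 3)], W.j = 0 → W.mordellWeilRank = 1 →
        Finite (AddCommGroup.primaryComponent W.sha 3) →
        ∃ D : KatoDescentDatum 3, Nonempty (KatoDescentDatumPinH2 W 3 D) ∧
          ∃ a b : ℕ,
            Ideal.span {((3 : ℕ) : IwasawaAlgebra 3) ^ a} * Module.charIdeal (IwasawaAlgebra 3) D.H2 =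
              Ideal.span {((3 : ℕ) : IwasawaAlgebra 3) ^ b} *
                Module.charIdeal (IwasawaAlgebra 3) (D.H ⧸ (IwasawaAlgebra 3) ∙ D.z) :=
  fun W _ _ _ hj hrank hsha ↦
    exists_pin_charIdeal_rel_of_nontrivial_of_rankOne W 3 (fun κ γ hκ hγ I ↦ hNT W κ γ hκ hγ I hj hrank hsha)
      hrank hsha

/-- **Reading (3.1′) of the road at `j = 0`, `p = 3`, on every v2-pinned datum, from (NT) alone.** For `W` globally
minimal elliptic with `j(W) = 0`, `rank W(ℚ) = 1`, `Ш(W)[3^∞]` finite, and every abstract datum `D` admitting a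
v2 pin: `D.H2/T·D.H2` is finite — GRANTED the crux-local (NT) at `p = 3`. Proof: on the pin's own `I = 𝐇¹_Γ(T₃W)`
(f.g. by (α) `module_finite_of_isCyclotomic`, torsion free by `isTorsionFree`, non-zero by (NT)) the descent cokernel
`H¹(ℤ[1/3], T₃W) / proj₀(𝐇¹_Γ/T)` is finite by `IwasawaH1Data.finite_descentCokernel_of_rank_le_one` (p501874) from
(14.14.1)-injectivity (`TwistTate.mem_TSubmodule_of_proj_zero_eq_zero`, p510488) and (R1)
(`rank_integralH1_layerZero_le_one`, p508547); transport to `D.H2/T` along the pin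
(`finite_coinvariants_H2_iff_finite_descentCokernel`). CONDITIONAL on (NT) only.
[cite: Kato2004Asterisque, §14.9 (14.9.3) (p. 240), §14.14 (14.14.1)–(14.14.2) (p. 243), Thm. 12.4 (2) (p. 221)]
[cite: AlpogeBhargavaShnidman2022, App. A §10.1.3 (p. 34)] -/
theorem reading31_jZero_three_of_nontrivialAtPin
    (hNT : ∀ (W : WeierstrassCurve ℚ) [W.IsElliptic] [ContinuousSMul ℤ_[3] (W.tateModule 3)]
      (κ : ZpExtension ℚ 3) (γ : absoluteGaloisGroup ℚ), κ.IsCyclotomic → κ.IsTopGenerator γ →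
        ∀ I : IwasawaH1Data W 3 κ γ, W.j = 0 → W.mordellWeilRank = 1 →
          Finite (AddCommGroup.primaryComponent W.sha 3) → Nontrivial I.H) :
    ∀ (W : WeierstrassCurve ℚ) [W.IsElliptic] [W.IsGloballyMinimal]
      [ContinuousSMul ℤ_[3] (W.tateModule 3)] (D : KatoDescentDatum 3), W.j = 0 →
        Nonempty (KatoDescentDatumPinH2 W 3 D) → W.mordellWeilRank = 1 →
          Finite (AddCommGroup.primaryComponent W.sha 3) →
            Finite (IwasawaAlgebra.coinvariants 3 D.H2) := by
  intro W _ _ _ D hj hD hrank hsha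
  obtain ⟨pin⟩ := hD
  haveI := IwasawaH1Data.module_finite_of_isCyclotomic pin.isCyclotomic pin.isTopGenerator pin.I
  haveI := pin.I.isTorsionFree pin.isTopGenerator
  haveI : Nontrivial pin.I.H := hNT W pin.κ pin.γ pin.isCyclotomic pin.isTopGenerator pin.I hj hrank hsha
  haveI := hsha
  exact pin.finite_coinvariants_H2_iff_finite_descentCokernel.mpr
    (pin.I.finite_descentCokernel_of_rank_le_one
      (fun x hx ↦ TwistTate.mem_TSubmodule_of_proj_zero_eq_zero W 3 pin.κ pin.isCyclotomic
        pin.isTopGenerator pin.I x hx)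
      (rank_integralH1_layerZero_le_one W 3 pin.κ hrank))

/-! ## §2 The census: crux B ⟸ six refereed theorems ∧ (NT) ∧ `PRFormulaAtThreeH2` -/

/-- **CRUX B ⟸ SIX REFEREED THEOREMS ∧ (NT) ∧ `PRFormulaAtThreeH2`, (NT) crux-local at `p = 3`** — the sharpest
census of the Kato–zeta road on stmt-BirchSwinnertonDyer-19160 after (α), (R1), (R2). Displayed: `3`-parity,
modularity, Hoffstein–Luo, Kato's finiteness theorem, existence of Heegner points, Gross–Zagier + Kolyvagin
(conjuncts 1–6 of the registered `stub_refereedInputs`); (NT) «for every `j = 0` curve `W` of rank one with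
`Ш(W)[3^∞]` finite and every cyclotomic pin at `p = 3`, `𝐇¹_Γ(T₃W) ≠ 0`» (what remains of conjunct 7 `thm12_4`);
`PRFormulaAtThreeH2` (the research stub). In between, tree theorems only: §1 (`readingRK_…`, `reading31_…`),
(3.1″) `reading31b_three_of_fact` fed with `Kato2004.locP_kernel_isTorsion_of_rankOne_holds` (p484260), and the
at-the-pin composition `MordellShaFreeCutKatoZetaRoadPinnedH2AtPin.cruxB_of_prFormulaH2_of_readingsAtPin`.
CONDITIONAL; closes nothing; nothing about (NT), PR₃, crux B, the leaf or BSD is proved.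
[cite: Kato2004Asterisque, Thm. 12.4 (2) (p. 221), §12.2 (12.2.2) (p. 220), §14.14, Cor. 14.3]
[cite: AlpogeBhargavaShnidman2022, App. A Thm. 10.1, Thm. 10.6, Thm. 10.8, §10.1.3] [cite: GrossZagier1986, Thm. I.6.3 with V.§2] -/
theorem cruxB_of_sixFacts_of_nontrivialAtPin_of_prFormulaH2
    (hpar : ∀ (W : WeierstrassCurve ℚ) [W.IsElliptic] (p : ℕ) [Fact p.Prime], p_parity W p)
    (hmod : ModularForms.exists_isNewformOf) (hHL : HoffsteinLuo1997_exists_twist_L_one_ne_zero)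
    (hKato : ∀ (W : WeierstrassCurve ℚ) [W.IsElliptic] (p : ℕ) [Fact p.Prime],
      kato_finite_of_L_one_ne_zero W p)
    (hHP : ∀ (W : WeierstrassCurve ℚ) (K : Type) [Field K] [NumberField K],
      exists_isHeegnerPoint W K)
    (hGZ : ∀ (W : WeierstrassCurve ℚ) (N : ℕ) [NeZero N] (K : Type) [Field K] [NumberField K],
      analyticRankEK_eq_one_iff_heegner_nonTorsion W N K)
    (hNT : ∀ (W : WeierstrassCurve ℚ) [W.IsElliptic] [ContinuousSMul ℤ_[3] (W.tateModule 3)]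
      (κ : ZpExtension ℚ 3) (γ : absoluteGaloisGroup ℚ), κ.IsCyclotomic → κ.IsTopGenerator γ →
        ∀ I : IwasawaH1Data W 3 κ γ, W.j = 0 → W.mordellWeilRank = 1 →
          Finite (AddCommGroup.primaryComponent W.sha 3) → Nontrivial I.H)
    (hPR : PRFormulaAtThreeH2) :
    AnalyticRankOneOfRankOneFiniteShaThree :=
  cruxB_of_prFormulaH2_of_readingsAtPin hpar hmod hHL hKato hHP hGZ
    (readingRK_jZero_three_of_nontrivialAtPin hNT) (reading31_jZero_three_of_nontrivialAtPin hNT)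
    (reading31b_three_of_fact locP_kernel_isTorsion_of_rankOne_holds) hPR

/-- **CRUX B ⟸ SIX REFEREED THEOREMS ∧ (NT) ∧ `PRFormulaAtThreeH2`, (NT) global in the `Nontrivial` currency** —
(NT) displayed as «`𝐇¹_Γ(T_pW) ≠ 0` on every cyclotomic pin, every `W/ℚ`, every `p`» (token for token the
conclusion of `Kato2004.nontrivial_iwasawaH1_of_thm12_4`, p514042: the lower half of Kato Thm. 12.4 (2) = the
Euler-system-free inequality half of (12.2.2), Tate–Perrin-Riou Euler–Poincaré). CONDITIONAL; closes nothing.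
[cite: Kato2004Asterisque, §12.2 (12.2.2) (p. 220) and Thm. 12.4 (2) (p. 221)]
[cite: AlpogeBhargavaShnidman2022, App. A Thm. 10.1, Thm. 10.8, §10.1.3] -/
theorem cruxB_of_sixFacts_of_nontrivial_of_prFormulaH2
    (hpar : ∀ (W : WeierstrassCurve ℚ) [W.IsElliptic] (p : ℕ) [Fact p.Prime], p_parity W p)
    (hmod : ModularForms.exists_isNewformOf) (hHL : HoffsteinLuo1997_exists_twist_L_one_ne_zero)
    (hKato : ∀ (W : WeierstrassCurve ℚ) [W.IsElliptic] (p : ℕ) [Fact p.Prime],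
      kato_finite_of_L_one_ne_zero W p)
    (hHP : ∀ (W : WeierstrassCurve ℚ) (K : Type) [Field K] [NumberField K],
      exists_isHeegnerPoint W K)
    (hGZ : ∀ (W : WeierstrassCurve ℚ) (N : ℕ) [NeZero N] (K : Type) [Field K] [NumberField K],
      analyticRankEK_eq_one_iff_heegner_nonTorsion W N K)
    (hNT : ∀ (W : WeierstrassCurve ℚ) [W.IsElliptic] (p : ℕ) [Fact p.Prime]
      [ContinuousSMul ℤ_[p] (W.tateModule p)] (κ : ZpExtension ℚ p) (γ : absoluteGaloisGroup ℚ),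
      κ.IsCyclotomic → κ.IsTopGenerator γ → ∀ I : IwasawaH1Data W p κ γ, Nontrivial I.H)
    (hPR : PRFormulaAtThreeH2) :
    AnalyticRankOneOfRankOneFiniteShaThree :=
  cruxB_of_sixFacts_of_nontrivialAtPin_of_prFormulaH2 hpar hmod hHL hKato hHP hGZ
    (fun W _ _ κ γ hκ hγ I _ _ _ ↦ hNT W 3 κ γ hκ hγ I) hPR

/-- **(NT) in the rank currency implies (NT) in the `Nontrivial` currency**: «`1 ≤ rank_Λ 𝐇¹_Γ(T_pW)` on every
cyclotomic pin» ⟹ «`𝐇¹_Γ(T_pW) ≠ 0` on every cyclotomic pin» (a subsingleton module has rank `0`). The hypothesis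
is, binder for binder, the consequence `1 ≤ rank` of Kato's Euler–Poincaré identity (12.2.2) on the pin (the body
named by plan g19 RULING-5 (3) for the typer's Literature def `Kato2004.one_le_rank_iwasawaH1`).
[cite: Kato2004Asterisque, §12.2 (12.2.2) (p. 220) and Thm. 12.4 (2) (p. 221)] -/
theorem nontrivial_iwasawaH1_of_one_le_rank
    (h : ∀ (W : WeierstrassCurve ℚ) [W.IsElliptic] (p : ℕ) [Fact p.Prime]
      [ContinuousSMul ℤ_[p] (W.tateModule p)] (κ : ZpExtension ℚ p) (γ : absoluteGaloisGroup ℚ),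
      κ.IsCyclotomic → κ.IsTopGenerator γ → ∀ I : IwasawaH1Data W p κ γ,
        1 ≤ Module.rank (IwasawaAlgebra p) I.H) :
    ∀ (W : WeierstrassCurve ℚ) [W.IsElliptic] (p : ℕ) [Fact p.Prime]
      [ContinuousSMul ℤ_[p] (W.tateModule p)] (κ : ZpExtension ℚ p) (γ : absoluteGaloisGroup ℚ),
      κ.IsCyclotomic → κ.IsTopGenerator γ → ∀ I : IwasawaH1Data W p κ γ, Nontrivial I.H := by
  intro W _ p _ _ κ γ hκ hγ I
  by_contra hnt
  rw [not_nontrivial_iff_subsingleton] at hnt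
  have h0 : Module.rank (IwasawaAlgebra p) I.H = 0 := rank_subsingleton' _ _
  have h1 := h W p κ γ hκ hγ I
  rw [h0] at h1
  exact lt_irrefl (0 : Cardinal) (zero_lt_one.trans_le h1)

/-- **CRUX B ⟸ SIX REFEREED THEOREMS ∧ (NT) ∧ `PRFormulaAtThreeH2`, (NT) global in the rank currency** — (NT)
displayed as «`1 ≤ rank_Λ 𝐇¹_Γ(T_pW)` on every cyclotomic pin» = Kato (12.2.2)'s consequence (Euler–Poincaré:
`rank_Λ 𝐇¹ − rank_Λ 𝐇² = rank_{ℤ_p} T⁻ = 1`; refereed twin Greenberg LNM 1716 §4), binder for binder the body of the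
typer's target `Kato2004.one_le_rank_iwasawaH1` (plan g19 RULING-5 (3)). The v1h READY body's `_of_stubs` is the
bundled form `cruxB_of_RI7prime_of_prFormulaH2` below. CONDITIONAL; closes nothing.
[cite: Kato2004Asterisque, §12.2 (12.2.2) (p. 220), Thm. 12.4 (2) (p. 221), §14.14, Cor. 14.3]
[cite: GreenbergLNM1716, §4, proof of Prop. 4.9] [cite: AlpogeBhargavaShnidman2022, App. A Thm. 10.1, Thm. 10.8, §10.1.3] -/
theorem cruxB_of_sixFacts_of_oneLeRank_of_prFormulaH2
    (hpar : ∀ (W : WeierstrassCurve ℚ) [W.IsElliptic] (p : ℕ) [Fact p.Prime], p_parity W p)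
    (hmod : ModularForms.exists_isNewformOf) (hHL : HoffsteinLuo1997_exists_twist_L_one_ne_zero)
    (hKato : ∀ (W : WeierstrassCurve ℚ) [W.IsElliptic] (p : ℕ) [Fact p.Prime],
      kato_finite_of_L_one_ne_zero W p)
    (hHP : ∀ (W : WeierstrassCurve ℚ) (K : Type) [Field K] [NumberField K],
      exists_isHeegnerPoint W K)
    (hGZ : ∀ (W : WeierstrassCurve ℚ) (N : ℕ) [NeZero N] (K : Type) [Field K] [NumberField K],
      analyticRankEK_eq_one_iff_heegner_nonTorsion W N K)
    (h1 : ∀ (W : WeierstrassCurve ℚ) [W.IsElliptic] (p : ℕ) [Fact p.Prime]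
      [ContinuousSMul ℤ_[p] (W.tateModule p)] (κ : ZpExtension ℚ p) (γ : absoluteGaloisGroup ℚ),
      κ.IsCyclotomic → κ.IsTopGenerator γ → ∀ I : IwasawaH1Data W p κ γ,
        1 ≤ Module.rank (IwasawaAlgebra p) I.H)
    (hPR : PRFormulaAtThreeH2) :
    AnalyticRankOneOfRankOneFiniteShaThree :=
  cruxB_of_sixFacts_of_nontrivial_of_prFormulaH2 hpar hmod hHL hKato hHP hGZ
    (nontrivial_iwasawaH1_of_one_le_rank h1) hPR

/-- **Crux B from the BUNDLED seven-conjunct shape RI7′ = six refereed theorems ∧ (NT, rank currency) and the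
research statement** — the `_of_stubs` one-liner of a v1h skeleton whose `stub_refereedInputs` carries, as 7th
conjunct, the typer's def `Kato2004.one_le_rank_iwasawaH1` (whose body this conjunct is, binder for binder) in
place of `Kato2004.thm12_4`. CONDITIONAL; closes nothing.
[cite: Kato2004Asterisque, §12.2 (12.2.2) (p. 220), Thm. 12.4 (2) (p. 221), Cor. 14.3]
[cite: DokchitserDokchitserAnnals2010, Thm. 1.4] [cite: GrossZagier1986, Thm. I.6.3 with V.§2] [cite: Gross1984, §§3–4] -/
theorem cruxB_of_RI7prime_of_prFormulaH2
    (RI : (∀ (W : WeierstrassCurve ℚ) [W.IsElliptic] (p : ℕ) [Fact p.Prime], p_parity W p) ∧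
      ModularForms.exists_isNewformOf ∧
      HoffsteinLuo1997_exists_twist_L_one_ne_zero ∧
      (∀ (W : WeierstrassCurve ℚ) [W.IsElliptic] (p : ℕ) [Fact p.Prime],
        kato_finite_of_L_one_ne_zero W p) ∧
      (∀ (W : WeierstrassCurve ℚ) (K : Type) [Field K] [NumberField K], exists_isHeegnerPoint W K) ∧
      (∀ (W : WeierstrassCurve ℚ) (N : ℕ) [NeZero N] (K : Type) [Field K] [NumberField K],
        analyticRankEK_eq_one_iff_heegner_nonTorsion W N K) ∧
      (∀ (W : WeierstrassCurve ℚ) [W.IsElliptic] (p : ℕ) [Fact p.Prime]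
        [ContinuousSMul ℤ_[p] (W.tateModule p)] (κ : ZpExtension ℚ p) (γ : absoluteGaloisGroup ℚ),
        κ.IsCyclotomic → κ.IsTopGenerator γ → ∀ I : IwasawaH1Data W p κ γ,
          1 ≤ Module.rank (IwasawaAlgebra p) I.H))
    (hPR : PRFormulaAtThreeH2) :
    AnalyticRankOneOfRankOneFiniteShaThree :=
  cruxB_of_sixFacts_of_oneLeRank_of_prFormulaH2 RI.1 RI.2.1 RI.2.2.1 RI.2.2.2.1 RI.2.2.2.2.1
    RI.2.2.2.2.2.1 RI.2.2.2.2.2.2 hPR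

/-! ## §3 Monotonicity: the substitute is WEAKER than the replaced conjunct (ACT TEST (i)) -/

/-- **`Kato2004.thm12_4` implies (NT) in the rank currency** («`1 ≤ rank_Λ 𝐇¹_Γ(T_pW)` on every cyclotomic pin»;
one line: the rank-one clause of Thm. 12.4 (2)). The converse is not claimed. [cite: Kato2004Asterisque, Thm. 12.4 (2) (p. 221)] -/
theorem one_le_rank_iwasawaH1_of_thm12_4 (h12 : thm12_4) :
    ∀ (W : WeierstrassCurve ℚ) [W.IsElliptic] (p : ℕ) [Fact p.Prime]
      [ContinuousSMul ℤ_[p] (W.tateModule p)] (κ : ZpExtension ℚ p) (γ : absoluteGaloisGroup ℚ),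
      κ.IsCyclotomic → κ.IsTopGenerator γ → ∀ I : IwasawaH1Data W p κ γ,
        1 ≤ Module.rank (IwasawaAlgebra p) I.H :=
  fun W _ p _ _ κ γ hκ hγ I ↦ ((h12 W p κ γ hκ hγ I).2.1.2).ge

/-- **RI7 ⟹ RI7′** (ACT TEST (i) certificate for a v1g → v1h re-cut: the registered seven-conjunct bundle with
`Kato2004.thm12_4` implies the bundle with `thm12_4` replaced by (NT) in the rank currency; conjuncts 1–6 unchanged).
Composed with `cruxB_of_RI7prime_of_prFormulaH2` it re-proves, through the (NT) road, the statement of the landed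
`MordellShaFreeCutKatoZetaRoadSevenFactsCensus.cruxB_of_RI7_of_prFormulaH2` (p512030) — the re-cut is content-neutral for crux B.
[cite: Kato2004Asterisque, Thm. 12.4 (2) (p. 221) and §12.2 (12.2.2) (p. 220)] -/
theorem RI7prime_of_RI7
    (RI : (∀ (W : WeierstrassCurve ℚ) [W.IsElliptic] (p : ℕ) [Fact p.Prime], p_parity W p) ∧
      ModularForms.exists_isNewformOf ∧
      HoffsteinLuo1997_exists_twist_L_one_ne_zero ∧
      (∀ (W : WeierstrassCurve ℚ) [W.IsElliptic] (p : ℕ) [Fact p.Prime],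
        kato_finite_of_L_one_ne_zero W p) ∧
      (∀ (W : WeierstrassCurve ℚ) (K : Type) [Field K] [NumberField K], exists_isHeegnerPoint W K) ∧
      (∀ (W : WeierstrassCurve ℚ) (N : ℕ) [NeZero N] (K : Type) [Field K] [NumberField K],
        analyticRankEK_eq_one_iff_heegner_nonTorsion W N K) ∧
      thm12_4) :
    (∀ (W : WeierstrassCurve ℚ) [W.IsElliptic] (p : ℕ) [Fact p.Prime], p_parity W p) ∧
      ModularForms.exists_isNewformOf ∧
      HoffsteinLuo1997_exists_twist_L_one_ne_zero ∧
      (∀ (W : WeierstrassCurve ℚ) [W.IsElliptic] (p : ℕ) [Fact p.Prime],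
        kato_finite_of_L_one_ne_zero W p) ∧
      (∀ (W : WeierstrassCurve ℚ) (K : Type) [Field K] [NumberField K], exists_isHeegnerPoint W K) ∧
      (∀ (W : WeierstrassCurve ℚ) (N : ℕ) [NeZero N] (K : Type) [Field K] [NumberField K],
        analyticRankEK_eq_one_iff_heegner_nonTorsion W N K) ∧
      (∀ (W : WeierstrassCurve ℚ) [W.IsElliptic] (p : ℕ) [Fact p.Prime]
        [ContinuousSMul ℤ_[p] (W.tateModule p)] (κ : ZpExtension ℚ p) (γ : absoluteGaloisGroup ℚ),
        κ.IsCyclotomic → κ.IsTopGenerator γ → ∀ I : IwasawaH1Data W p κ γ,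
          1 ≤ Module.rank (IwasawaAlgebra p) I.H) :=
  ⟨RI.1, RI.2.1, RI.2.2.1, RI.2.2.2.1, RI.2.2.2.2.1, RI.2.2.2.2.2.1,
    one_le_rank_iwasawaH1_of_thm12_4 RI.2.2.2.2.2.2⟩

/-! ## §4 RI7′ in the DEF-NAMED currency (the registered v1h line): crux B ⟸ six refereed theorems ∧ `Kato2004.one_le_rank_iwasawaH1` ∧ `PRFormulaAtThreeH2`

Written (seat g22) after the v1h input `Kato2004.one_le_rank_iwasawaH1` (p516793), its proofs file (p517993) and the
plan's registry act (xvi) (2026-08-27T09:30:19Z; skeleton sha256 5febefdc…) whose `stub_refereedInputs` names the fact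
as 7th conjunct. §2 displays that conjunct by its BODY (written before the def existed): the two bundles are the same
proposition by unfolding the def, so §2's `cruxB_of_RI7prime_of_prFormulaH2` and §4's theorem serve the registry
interchangeably, and RI7 ⟹ registered RI7′ is §3's `RI7prime_of_RI7` read through the def (fact level p517993).
S2 twin: `CongruentShaFreeCutKatoZetaRoadNontrivialH1` §4 (seat bsd-cn100-s2-c3 g14). CONDITIONAL; closes nothing. -/

/-- **CENSUS in the def-named RI7′ currency.** Crux B `AnalyticRankOneOfRankOneFiniteShaThree` follows from the six
refereed theorems of the line of record, the NAMED FACT `Kato2004.one_le_rank_iwasawaH1` («`1 ≤ rank_Λ 𝐇¹_Γ(T_pW)` at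
every cyclotomic pin» — Kato (12.2.2)'s Euler-system-free inequality half; the LOWER bound in Thm. 12.4 (2)) and the
research statement `PRFormulaAtThreeH2`: the fact gives (NT) (`Kato2004.nontrivial_of_one_le_rank_iwasawaH1`, p517993)
and `cruxB_of_sixFacts_of_nontrivial_of_prFormulaH2` concludes; the UPPER bound of Thm. 12.4 (zeta elements, Rohrlich)
is not used — `rank_Λ 𝐇¹ ≤ 1` comes from (R1)/(R2) under the crux hypotheses. Argument order = the registered RI7′
conjuncts, then PR₃. CONDITIONAL on the displayed hypotheses; closes nothing; BSD is not proved by any of this.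
[cite: Kato2004Asterisque, §12.2 (12.2.2) (p. 220), Thm. 12.4 (2) (p. 221), §14.14 (14.14.1) (p. 243), Cor. 14.3]
[cite: AlpogeBhargavaShnidman2022, App. A Thm. 10.1, Thm. 10.6, Thm. 10.8, §10.1.3 (pp. 33–34)] -/
theorem cruxB_of_sixFacts_of_oneLeRankFact_of_prFormulaH2
    (hpar : ∀ (W : WeierstrassCurve ℚ) [W.IsElliptic] (p : ℕ) [Fact p.Prime], p_parity W p)
    (hmod : ModularForms.exists_isNewformOf) (hHL : HoffsteinLuo1997_exists_twist_L_one_ne_zero)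
    (hKato : ∀ (W : WeierstrassCurve ℚ) [W.IsElliptic] (p : ℕ) [Fact p.Prime],
      kato_finite_of_L_one_ne_zero W p)
    (hHP : ∀ (W : WeierstrassCurve ℚ) (K : Type) [Field K] [NumberField K],
      exists_isHeegnerPoint W K)
    (hGZ : ∀ (W : WeierstrassCurve ℚ) (N : ℕ) [NeZero N] (K : Type) [Field K] [NumberField K],
      analyticRankEK_eq_one_iff_heegner_nonTorsion W N K)
    (h1 : one_le_rank_iwasawaH1) (hPR : PRFormulaAtThreeH2) :
    AnalyticRankOneOfRankOneFiniteShaThree :=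
  cruxB_of_sixFacts_of_nontrivial_of_prFormulaH2 hpar hmod hHL hKato hHP hGZ
    (nontrivial_of_one_le_rank_iwasawaH1 h1) hPR

/-- **Crux B from the BUNDLED, REGISTERED RI7′ and the research statement — the registered v1h skeleton's `_of_stubs`
as a tree theorem.** `RI` is, token for token, the registered signature of `stub_refereedInputs` on
stmt-BirchSwinnertonDyer-19160 (six refereed theorems — `3`-parity, modularity, Hoffstein–Luo, Kato's finiteness
theorem, Heegner points over `K`, Gross–Zagier + Kolyvagin — ∧ `Kato2004.one_le_rank_iwasawaH1` BY NAME), and `hPR`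
that of `stub_prFormulaAtThree`: the kernel certificate, in the tree, that the two registered stubs of the line
`kato-zeta-perrin-riou` v1h (skeleton sha256 5febefdc…) are jointly sufficient for crux B BY NAME (§2's
`cruxB_of_RI7prime_of_prFormulaH2` is the same statement with the 7th conjunct displayed by its body). CONDITIONAL;
closes nothing; nothing about the seven citation-borne inputs or `PRFormulaAtThreeH2` is proved here.
[cite: Kato2004Asterisque, §12.2 (12.2.2) (p. 220), Thm. 12.4 (2) (p. 221), Cor. 14.3]
[cite: DokchitserDokchitserAnnals2010, Thm. 1.4] [cite: GrossZagier1986, Thm. I.6.3 with V.§2] [cite: Gross1984, §§3–4]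
[cite: AlpogeBhargavaShnidman2022, App. A Thm. 10.1, Thm. 10.8, §10.1.3 (pp. 33–34)] -/
theorem cruxB_of_registeredRI7prime_of_prFormulaH2
    (RI : (∀ (W : WeierstrassCurve ℚ) [W.IsElliptic] (p : ℕ) [Fact p.Prime], p_parity W p) ∧
      ModularForms.exists_isNewformOf ∧
      HoffsteinLuo1997_exists_twist_L_one_ne_zero ∧
      (∀ (W : WeierstrassCurve ℚ) [W.IsElliptic] (p : ℕ) [Fact p.Prime],
        kato_finite_of_L_one_ne_zero W p) ∧
      (∀ (W : WeierstrassCurve ℚ) (K : Type) [Field K] [NumberField K], exists_isHeegnerPoint W K) ∧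
      (∀ (W : WeierstrassCurve ℚ) (N : ℕ) [NeZero N] (K : Type) [Field K] [NumberField K],
        analyticRankEK_eq_one_iff_heegner_nonTorsion W N K) ∧
      one_le_rank_iwasawaH1)
    (hPR : PRFormulaAtThreeH2) :
    AnalyticRankOneOfRankOneFiniteShaThree :=
  cruxB_of_sixFacts_of_oneLeRankFact_of_prFormulaH2 RI.1 RI.2.1 RI.2.2.1 RI.2.2.2.1 RI.2.2.2.2.1
    RI.2.2.2.2.2.1 RI.2.2.2.2.2.2 hPR

end Summit.BirchSwinnertonDyer.BirchSwinnertonDyer.Theorems.MordellShaFreeCutKatoZetaRoadNontrivialH1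

end
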